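import Summits.HubbardSuperconductivity.HubbardSuperconductivity.Theorems.AnisotropyChordTransferFibre3FinXDGM3Nine
import Summits.HubbardSuperconductivity.HubbardSuperconductivity.Theorems.AnisotropyChordTransferFibre3FinXDGM3Ten
import Summits.HubbardSuperconductivity.HubbardSuperconductivity.Theorems.AnisotropyChordTransferFibre3FinXDGM3Eleven
import Summits.HubbardSuperconductivity.HubbardSuperconductivity.Theorems.AnisotropyChordTransferFibre3FinXDGM3Twelve
import Summits.HubbardSuperconductivity.HubbardSuperconductivity.Theorems.AnisotropyChordTransferFibre3FinXDGM3Thirteen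
import Summits.HubbardSuperconductivity.HubbardSuperconductivity.Theorems.AnisotropyChordTransferFibre3FinXDGM3Fourteen
import Summits.HubbardSuperconductivity.HubbardSuperconductivity.Theorems.AnisotropyChordTransferFibre3FinXDGM3Fifteen
import Summits.HubbardSuperconductivity.HubbardSuperconductivity.Theorems.AnisotropyChordTransferFibre3FinXDGM3Sixteen
import Summits.HubbardSuperconductivity.HubbardSuperconductivity.Theorems.AnisotropyChordTransferFibre3FinXDGM3Seventeen
import Summits.HubbardSuperconductivity.HubbardSuperconductivity.Theorems.AnisotropyChordTransferFibre3FinXDGM3Eighteen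
import Summits.HubbardSuperconductivity.HubbardSuperconductivity.Theorems.AnisotropyChordTransferFibre3FinXDGM3Nineteen
import Summits.HubbardSuperconductivity.HubbardSuperconductivity.Theorems.AnisotropyChordTransferFibre3FinXDGM3Twenty
import Summits.HubbardSuperconductivity.HubbardSuperconductivity.Theorems.AnisotropyChordTransferFibre3FinXDGM3TwentyOne
import Summits.HubbardSuperconductivity.HubbardSuperconductivity.Theorems.AnisotropyChordTransferFibre3FinXDGM3TwentyTwo
import Summits.HubbardSuperconductivity.HubbardSuperconductivity.Theorems.AnisotropyChordTransferFibre3FinXDGM3TwentyThree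
import Summits.HubbardSuperconductivity.HubbardSuperconductivity.Theorems.AnisotropyChordTransferFibre3FinXDGM3TwentyFour

/-!
# Route `AnisotropyChord` / H0 rotor rung: ★★★ GM₃ FOR ALL `9 ≤ L ≤ 24`, UNCONDITIONALLY (`0 < Δ ≤ 0.98`)

The sixteen per-`L` kernel-certified theorems `gm3_nine … gm3_twentyFour` (…FinXDGM3<Word>: three crux rows N₁, C, D + regime clause, cell by cell,
glued by `FinXD.gm3_of_gmCheck` / `gm3_of_gmCheck2`) combined by `interval_cases`.  Prover seat `hubbard-h0-rotor-p3` g7; helper for piece A =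
stmt-HubbardSuperconductivity-23918 of rung 19089 (`--supports`, helper class).  WHAT THIS IS NOT: nothing here proves superconductivity in the Hubbard
model (rotor TARGET as worded stays FALSE, g15 verdict); it discharges the finite range `9 ≤ L ≤ 24` of ONE conditional reduction's GM₃ input.
-/

set_option linter.dupNamespace false
set_option autoImplicit false

namespace Summit.HubbardSuperconductivity.HubbardSuperconductivity.Theorems.AnisotropyChord.Transfer.Fibre3

/-- ★★★ **GM₃ for every `9 ≤ L ≤ 24` and every `0 < Δ ≤ 0.98`**: `GM3Fibre L Δ` (kernel-certified per `L`, zero data). [folklore] -/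
theorem gm3_range (L : ℕ) [NeZero L] (h9 : 9 ≤ L) (h24 : L ≤ 24) {Δ : ℝ} (hΔ0 : 0 < Δ) (hΔ1 : Δ ≤ 0.98) : GM3Fibre L Δ := by
  interval_cases L
  · exact gm3_nine hΔ0 hΔ1
  · exact gm3_ten hΔ0 hΔ1
  · exact gm3_eleven hΔ0 hΔ1
  · exact gm3_twelve hΔ0 hΔ1
  · exact gm3_thirteen hΔ0 hΔ1
  · exact gm3_fourteen hΔ0 hΔ1
  · exact gm3_fifteen hΔ0 hΔ1
  · exact gm3_sixteen hΔ0 hΔ1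
  · exact gm3_seventeen hΔ0 hΔ1
  · exact gm3_eighteen hΔ0 hΔ1
  · exact gm3_nineteen hΔ0 hΔ1
  · exact gm3_twenty hΔ0 hΔ1
  · exact gm3_twentyone hΔ0 hΔ1
  · exact gm3_twentytwo hΔ0 hΔ1
  · exact gm3_twentythree hΔ0 hΔ1
  · exact gm3_twentyfour hΔ0 hΔ1

end Summit.HubbardSuperconductivity.HubbardSuperconductivity.Theorems.AnisotropyChord.Transfer.Fibre3
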